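import Summits.AtomisticToContinuum.Crystallization.Theorems.ChartedZeroExcessLayeredLatticeLiouvilleZZZPA

/-!
# ChartedZeroExcess · LayeredLatticeLiouville ZZZP (lens-2 g84 NODE 84, W2 line of record) — part 2 of 2 (sequel of `…ChartedZeroExcessLayeredLatticeLiouvilleZZZPA`)

Split for the 400-line cap by the landing lane (hand-2 g40); the module docstring of part 1 (`…ChartedZeroExcessLayeredLatticeLiouvilleZZZPA`) describes the whole node.  Same namespace; all FQNs unchanged.
0 sorry; standard axioms.
-/

noncomputable section
open scoped BigOperators Classical InnerProductSpace RealInnerProductSpace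
open MeasureTheory Set Metric Filter Topology
open Literature.MathematicalPhysics.StatisticalMechanics (lennardJones)

namespace Summit.AtomisticToContinuum.Crystallization.Theorems.ChartedZeroExcessLayeredLatticeLiouville

open Summit.AtomisticToContinuum.Crystallization.Theorems.ChartedPlanarOrderRigidityDoor (E3)
open Summit.AtomisticToContinuum.Crystallization.Theorems.ChartedPlanarOrderDensityDichotomy (μS IsSep)
open Summit.AtomisticToContinuum.Crystallization.Theorems.ChartedPlanarOrderCleanScaleP (IsCleanP IsDoorSetP)
open Summit.AtomisticToContinuum.Crystallization.Theorems.ChartedPlanarOrderMesoCut (LayeredHom EnvClose)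
open Summit.AtomisticToContinuum.Crystallization.Theorems.ChartedPlanarOrderDoorLayeredOsc (IsTwoShellAffineGood)

/-! ### ZZZP-2  W2 «label-paired variational door»: (QEᴸ) `LabelSlavedFillingP`, (QCᴸ) `LabelSegmentCoercivityP`, and the glue
[MCMCᶜ] ⟸ (SC) ∧ (GL₂) ∧ (QEᴸ) ∧ (QCᴸ) (PROVED) -/

section LabelPairedDoor

/-- ★★★ **(QEᴸ) «LabelSlavedFillingP ϑc ϑ ϑp r rΘ q rsh ρ rm σ ϑr Rs ε rI ℓ dL aHi Λ θ s» — A SLAVED TAME CRITICAL FILLING EXISTS NEAR THE LABEL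
IMAGE OF THE CORE.**  Under the binders of (QE) `CoolMoatSlavedFillingP` verbatim (θ-good `aHi`-door set with summable pair sums, equilibrium
chart `(L, w)`, container `K ⊆ S ∩ B̄(x₀, q)`, `ϑp`-tame `rm`-core, `ϑc`-tame moat, injective enumeration `xf` of the `ρ`-core), for every cool
shadow crystal `C = placedCrystal L′ w′ U t` of the shell (`IsCoolShadowCrystal σ ϑr Rs ε r rI ℓ`, the output of (SC)) and every bond label `lab`
of the `ℓ`-zone into `C` read from `rΘ` (`IsBondLabel ε rΘ ℓ`, the output of (GL₂) — canonical by (BU₂)): there is a filling `y` of the same count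
which is (i) injective and off the frozen exterior `S ∖ core`, (iii) a CLAMPED CRITICAL POINT, (iv) `ϑ`-TAME at every site relative to the glued
configuration, and (ii′) within `dL` of the LABEL IMAGE sitewise: `dist (lab (xf i)) (y i) ≤ dL`.  Differs from (QE) exactly in clause (ii′):
the filling is slaved to the crystal patch `lab ∘ xf` (a subset of `C`, seam-compatible with the `ε`-registered exterior by the label's collar
clause), NOT matched to the actual loose core — so NO metric registration of the loose core is presupposed.  Mechanism (not typed here): the
load-path engine of tree YO-4 from the reference `y₀ := lab ∘ xf` through matching-free tube pieces (X1°)/(X2°) (tree (X1)/(X2ᴸ♮) with the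
`dm`-clause of `IsTubeReference` deleted; same census instruments NearBorn-T / FillTame-T), residual load `O(ε)` + `r⁻⁶` tails at the seam.
ANALYTIC · LOCAL · FINITE · UNDECIDED · TRUE-type for `ϑc ≤ ϑc⋆` (as (QE)) · INSTRUMENTABLE («LabelLoad-T»: relax the sampled cores from the
crystal patch `lab ∘ xf`; report max `dist(lab (xf i), y i)` against `dL` and the star misfit against `ϑ`).
Why it might fail: as (QE) — `C_d·ϑc` above the tameness budget at the sampled moat level (repair: the free moat dial); a label image that is
not seam-compatible (excluded: collar clause (iv) of `IsBondLabel` + covering (CV₂♮), tree ZZZOA `bondLabelCoveringP₂_record`).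
Sources: tree YO ((X1), (X2ᴸ), `coolMoatSlavedFillingP_of_loadPath`); tree YI ((QE)); E–Ming, Arch. Ration. Mech. Anal. 183 (2007) 241;
Ortner–Theil, Arch. Ration. Mech. Anal. 207 (2013) 1025; memo NODE-g84 §3. [this file, g84] -/
def LabelSlavedFillingP (ϑc ϑ ϑp r rΘ q rsh ρ rm σ ϑr Rs ε rI ℓ dL aHi Λ θ s : ℝ) : Prop :=
  ∀ δ : ℝ, 0 < δ → ∀ a : ℝ, 0 < a →
    ∀ S : Set E3, IsDoorSetP aHi δ S → (∀ z : E3, Summable fun y : S => lennardJones (dist z (y : E3))) →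
      (∀ p ∈ S, IsTwoShellAffineGood θ S p) →
        ∀ (L : E3 ≃L[ℝ] E3) (w : ℤ → E3), IsEquilChart a s Λ L w →
          ∀ (x₀ : E3) (K : Set E3), K ⊆ S → (∀ k ∈ K, dist k x₀ ≤ q) →
            IsTameOn ϑp S (LayeredHom (L : E3 →L[ℝ] E3) w) (coreOf S K rm) →
              IsTameOn ϑc S (LayeredHom (L : E3 →L[ℝ] E3) w) (moatIn S K r (r + rsh)) →
                ∀ (n : ℕ) (xf : Fin n → E3), Function.Injective xf → Set.range xf = coreOf S K ρ →
                  ∀ (L' : E3 →L[ℝ] E3) (w' : ℤ → E3) (U : E3 ≃ₗᵢ[ℝ] E3) (t : E3),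
                    IsCoolShadowCrystal σ ϑr Rs ε r rI ℓ S K (LayeredHom (L : E3 →L[ℝ] E3) w) L' w' U t →
                      ∀ lab : E3 → E3, IsBondLabel ε rΘ ℓ S K (placedCrystal L' w' U t) lab →
                        ∃ y : Fin n → E3, Function.Injective y ∧ Disjoint (Set.range y) (S \ coreOf S K ρ) ∧
                          HasFDerivAt (fun z : Fin n → E3 => clampedEnergy (S \ coreOf S K ρ) z) (0 : (Fin n → E3) →L[ℝ] ℝ) y ∧
                            (∀ i, IsTameStar ϑ ((S \ coreOf S K ρ) ∪ Set.range y) (LayeredHom (L : E3 →L[ℝ] E3) w) (y i)) ∧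
                              ∀ i, dist (lab (xf i)) (y i) ≤ dL

/-- ★★★ **(QCᴸ) «LabelSegmentCoercivityP ϑc ϑ ϑp r rΘ q rsh ρ rm σ ϑr Rs ε rI ℓ dL κ aHi Λ θ s» — FIRST-ORDER COERCIVITY OF THE CLAMPED ENERGY
ALONG THE LABEL SEGMENT.**  Under the same binders, for every cool shadow crystal `C`, every bond label `lab`, and every filling `y` that is
injective, off the exterior, CLAMPED-CRITICAL, `ϑ`-tame sitewise w.r.t. the glued configuration and within `dL` of the label image `lab ∘ xf`:
`clampedEnergy (S ∖ core) y + κ·Σᵢ dist(xf i, y i)² ≤ clampedEnergy (S ∖ core) xf` — the actual core sits ABOVE the crystalline critical filling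
by `κ` times its squared LABEL-PAIRED distance.  Sufficient (for `C²` energies, `y` critical): a HARMONIC FLOOR `D²(clampedEnergy)(z)[u, u] ≥
2κ‖u‖²` at every point `z = (1 − t)·y + t·xf` of the label segment.  The segment is BOND-COHERENT (a bond label is a local isomorphism of the
`12`-regular contact graphs, `IsBondLabel` (b) + injectivity + cleanliness), so every intermediate configuration has bond strains `≤ max(endpoint
strains) + (1 − cos(φ/2))` where `φ` is the rotation of the core star relative to its label image — COMPRESSION, the Born-safe direction (`≤ 2 %`
at `φ = 0.4`, `≤ 6 %` at `φ = 0.7`); a twisted core (memo FINDING-OM: strain `|D| ≈ 2|E| ≤ 4 %` relative to the label pairing, displacement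
`≈ 0.3`) is an ORDINARY member of this class — the orientation-locking obstruction of (CBL₂) is an energy fact here, not a kinematic one.
Differs from (QC) `MildClampedConvexityP` (tree YI) exactly in the pairing: (QC) pairs by index under the METRIC matching `dist(xf i, y i) ≤ dm =
1/2` (which presupposes the coarse registration (CM)); (QCᴸ) pairs by the LABEL and carries no metric hypothesis on the loose core.  STRONGER than
(QC) on the fat side (rotated / drifted cores with `dist(xf i, y i)` up to `≈ 1`); a kinematic rotation-drift bound `φ ≤ φ₀` (ATTACKABLE-M,
per-hop star-rotation continuity) would cut the fat side back if the census asks for it.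
CERT-type · LOCAL · FINITE · UNDECIDED · TRUE-type-expected (Born stability of `≤ 4 %`-strained, `≤ 6 %`-compressed clean Lennard-Jones
configurations in the clamped ball) · INSTRUMENTABLE («LabelSegmentBorn-T»: smallest clamped-Hessian eigenvalue along the label segments of
SYNTHETIC tame cores — twisted (FINDING-OM lens, embedded with its transition layer, memo FINDING-TL), bent, rolled up to `φ = 40°` — from their
relaxed crystal patches; PASS iff `λ_min ≥ 2κ` with `κ = 7/2000`, the tube mark of row 1237).
Why it might fail: a clean `ϑp`-tame core star rotated by `φ ≳ 50°` relative to its label image (chord compression `≳ 10 %`, beyond the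
Lennard-Jones compressive harmonic range) — kinematically allowed by per-hop drift `≈ 0.07 rad × ≤ 10` hops only in the adversarial worst case;
an unstable clamped phonon of a `4 %`-sheared intermediate configuration (the stiffness-drift caveat of (QC)); both decided by LabelSegmentBorn-T.
Sources: tree YI ((QC) and its why-it-might-fail); tree ZC (`IsBondLabel`); Wallace, Thermodynamics of Crystals (1972) (Born stability); E–Ming
2007 §2; memo FINDING-OM (g83), memo NODE-g84 §1–§3. [this file, g84] -/
def LabelSegmentCoercivityP (ϑc ϑ ϑp r rΘ q rsh ρ rm σ ϑr Rs ε rI ℓ dL κ aHi Λ θ s : ℝ) : Prop :=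
  ∀ δ : ℝ, 0 < δ → ∀ a : ℝ, 0 < a →
    ∀ S : Set E3, IsDoorSetP aHi δ S → (∀ z : E3, Summable fun y : S => lennardJones (dist z (y : E3))) →
      (∀ p ∈ S, IsTwoShellAffineGood θ S p) →
        ∀ (L : E3 ≃L[ℝ] E3) (w : ℤ → E3), IsEquilChart a s Λ L w →
          ∀ (x₀ : E3) (K : Set E3), K ⊆ S → (∀ k ∈ K, dist k x₀ ≤ q) →
            IsTameOn ϑp S (LayeredHom (L : E3 →L[ℝ] E3) w) (coreOf S K rm) →
              IsTameOn ϑc S (LayeredHom (L : E3 →L[ℝ] E3) w) (moatIn S K r (r + rsh)) →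
                ∀ (n : ℕ) (xf : Fin n → E3), Function.Injective xf → Set.range xf = coreOf S K ρ →
                  ∀ (L' : E3 →L[ℝ] E3) (w' : ℤ → E3) (U : E3 ≃ₗᵢ[ℝ] E3) (t : E3),
                    IsCoolShadowCrystal σ ϑr Rs ε r rI ℓ S K (LayeredHom (L : E3 →L[ℝ] E3) w) L' w' U t →
                      ∀ lab : E3 → E3, IsBondLabel ε rΘ ℓ S K (placedCrystal L' w' U t) lab →
                        ∀ y : Fin n → E3, Function.Injective y → Disjoint (Set.range y) (S \ coreOf S K ρ) →
                          HasFDerivAt (fun z : Fin n → E3 => clampedEnergy (S \ coreOf S K ρ) z) (0 : (Fin n → E3) →L[ℝ] ℝ) y →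
                            (∀ i, IsTameStar ϑ ((S \ coreOf S K ρ) ∪ Set.range y) (LayeredHom (L : E3 →L[ℝ] E3) w) (y i)) →
                              (∀ i, dist (lab (xf i)) (y i) ≤ dL) →
                                clampedEnergy (S \ coreOf S K ρ) y + κ * ∑ i, dist (xf i) (y i) ^ 2 ≤
                                  clampedEnergy (S \ coreOf S K ρ) xf

/-- (QCᴸ) is antitone in the modulus. [this file, g84] -/
theorem LabelSegmentCoercivityP.of_le {ϑc ϑ ϑp r rΘ q rsh ρ rm σ ϑr Rs ε rI ℓ dL κ κ' aHi Λ θ s : ℝ} (hκ : κ' ≤ κ)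
    (h : LabelSegmentCoercivityP ϑc ϑ ϑp r rΘ q rsh ρ rm σ ϑr Rs ε rI ℓ dL κ aHi Λ θ s) :
    LabelSegmentCoercivityP ϑc ϑ ϑp r rΘ q rsh ρ rm σ ϑr Rs ε rI ℓ dL κ' aHi Λ θ s :=
  fun δ hδ a ha S hS hsum hgood L w hLw x₀ K hKS hKq hmild hcool n xf hxf hrange L' w' U t hC lab hlab y hyinj hydisj hcrit htame hnear => by
    have key := h δ hδ a ha S hS hsum hgood L w hLw x₀ K hKS hKq hmild hcool n xf hxf hrange L' w' U t hC lab hlab y hyinj hydisj hcrit htame hnear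
    have hs : 0 ≤ ∑ i, dist (xf i) (y i) ^ 2 := Finset.sum_nonneg fun i _ => by positivity
    nlinarith [mul_le_mul_of_nonneg_right hκ hs]

/-- ★★★ **THE LABEL-PAIRED VARIATIONAL GLUE (PROVED): (SC) ∧ (GL₂) ∧ (QEᴸ)(dL) ∧ (QCᴸ)(dL, κ > 0) ⇒ [MCMCᶜ]** (`0 ≤ ρ`).  Enumerate the finite
`ρ`-core as `xf`; (SC) gives the cool shadow crystal `C`, (GL₂) a bond label `lab` into it; (QEᴸ) gives the tame critical filling `y` slaved to
`lab ∘ xf`; (QCᴸ) gives `E(y) + κ·Σ dist(xf i, y i)² ≤ E(xf)`; grand clamped minimality of the core with the equal-count replacement `R := y`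
gives `E(xf) ≤ E(y)`; hence `Σ dist² ≤ 0`, `y = xf`, the glued configuration is `S` itself, and every site of `K ⊆ core` carries a `ϑ`-tame star.
The proof is tree YI-5's, with the index pairing supplied by the label instead of a metric matching. [this file, g84] -/
theorem mildCoolMoatClampedCoreP_of_labelSlavedFilling_coercivity {ϑc ϑ ϑp r rΘ q rsh ρ rm σ ϑr Rs ε rI ℓ dL κ aHi Λ θ s : ℝ}
    (hκ : 0 < κ) (hρ : 0 ≤ ρ)
    (hSC : CoolZoneShadowCrystalP ϑc ϑp r q rsh rm σ ϑr Rs ε rI ℓ aHi Λ θ s)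
    (hGL : BondLabelP₂ ϑc ϑp r rΘ q rsh rm σ ϑr Rs ε rI ℓ aHi Λ θ s)
    (hE : LabelSlavedFillingP ϑc ϑ ϑp r rΘ q rsh ρ rm σ ϑr Rs ε rI ℓ dL aHi Λ θ s)
    (hC : LabelSegmentCoercivityP ϑc ϑ ϑp r rΘ q rsh ρ rm σ ϑr Rs ε rI ℓ dL κ aHi Λ θ s) :
    MildCoolMoatClampedCoreP ϑc ϑ ϑp r q rsh ρ rm aHi Λ θ s := by
  intro δ hδ a ha S hS hsum hgood L w hLw x₀ K hKS hKq hmild hcool hmin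
  have hKf : K.Finite :=
    (Literature.Probability.Process.LocalConfig.finite_inter_of_separated hδ hS.2.1 (isCompact_closedBall x₀ q)).subset
      fun k hk => ⟨mem_closedBall.2 (hKq k hk), hKS hk⟩
  obtain ⟨n, f, hf⟩ := (coreOf_finite hδ hS.2.1 hKf ρ).fin_embedding
  obtain ⟨L', w', U, t, hCr⟩ := hSC δ hδ a ha S hS hsum hgood L w hLw x₀ K hKS hKq hmild hcool
  obtain ⟨lab, hlab⟩ := hGL δ hδ a ha S hS hsum hgood L w hLw x₀ K hKS hKq hmild hcool L' w' U t hCr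
  obtain ⟨y, hyinj, hydisj, hcrit, htame, hnear⟩ :=
    hE δ hδ a ha S hS hsum hgood L w hLw x₀ K hKS hKq hmild hcool n f f.injective hf L' w' U t hCr lab hlab
  have hineq :=
    hC δ hδ a ha S hS hsum hgood L w hLw x₀ K hKS hKq hmild hcool n f f.injective hf L' w' U t hCr lab hlab y hyinj hydisj hcrit htame hnear
  have hmin' := hmin n f f.injective hf n y hyinj hydisj
  have hsum0 : ∑ i, dist (f i) (y i) ^ 2 ≤ 0 := by nlinarith
  have hzero : ∀ i, dist (f i) (y i) ^ 2 = 0 := fun i =>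
    (Finset.sum_eq_zero_iff_of_nonneg fun j _ => by positivity).1
      (le_antisymm hsum0 (Finset.sum_nonneg fun j _ => by positivity)) i (Finset.mem_univ i)
  have hyf : y = ⇑f := funext fun i => (dist_eq_zero.1 (pow_eq_zero_iff two_ne_zero |>.1 (hzero i))).symm
  have hglued : (S \ coreOf S K ρ) ∪ Set.range y = S := by
    rw [hyf, hf, sdiff_union_of_subset (coreOf_subset S K ρ)]
  intro k hk
  have hkcore : k ∈ coreOf S K ρ := ⟨hKS hk, k, hk, by rw [dist_self]; exact hρ⟩
  rw [← hf] at hkcore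
  obtain ⟨i, hi⟩ := hkcore
  have ht := htame i
  rw [hglued, hyf] at ht
  rw [← hi]
  exact ht

/-- **(SC) ∧ (GL₂) ∧ (QEᴸ) ∧ (QCᴸ) ⇒ [MCMC] (PROVED)** — through tree YHA `mildCoolMoatCorePG_of_mildClamped`. [this file, g84] -/
theorem mildCoolMoatCorePG_of_labelSlavedFilling_coercivity {ϑc ϑ ϑp r rΘ q rsh ρ rm σ ϑr Rs ε rI ℓ dL κ aHi Λ θ s : ℝ}
    (hκ : 0 < κ) (hρ : 0 ≤ ρ)
    (hSC : CoolZoneShadowCrystalP ϑc ϑp r q rsh rm σ ϑr Rs ε rI ℓ aHi Λ θ s)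
    (hGL : BondLabelP₂ ϑc ϑp r rΘ q rsh rm σ ϑr Rs ε rI ℓ aHi Λ θ s)
    (hE : LabelSlavedFillingP ϑc ϑ ϑp r rΘ q rsh ρ rm σ ϑr Rs ε rI ℓ dL aHi Λ θ s)
    (hC : LabelSegmentCoercivityP ϑc ϑ ϑp r rΘ q rsh ρ rm σ ϑr Rs ε rI ℓ dL κ aHi Λ θ s) :
    MildCoolMoatCorePG ϑc ϑ ϑp r q rsh rm aHi Λ θ s :=
  mildCoolMoatCorePG_of_mildClamped (mildCoolMoatClampedCoreP_of_labelSlavedFilling_coercivity hκ hρ hSC hGL hE hC)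

/-- ★★ **THE DOCKET-SHAPED INSTANCE (PROVED modulo its three hypotheses)**: at the record dials of the W-side (`ϑp = 1/10`, `r = 8`, `rΘ = 145/16`,
`q = 4`, `rsh = 12`, `ρ = rm = 16`, `σ = 17/20`, `ϑr = ε = 10⁻⁴`, `Rs = 5`, `rI = 10`, `ℓ = 43/2`, `aHi = 1`, `Λ = 2`, `θ = 1/16`, `s = 1/50`) and the
door's tameness level `ϑ = tameRadius`, with (GL₂) DISCHARGED by tree ZZZK `bondLabelP₂_record`: the mild door [MCMC](ϑc) follows from (SC)(ϑc),
(QEᴸ)(ϑc, dL) and (QCᴸ)(ϑc, dL, κ) for any `dL` and any `κ > 0` — the moat level `ϑc` stays the column's free dial. [this file, g84] -/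
theorem mildCoolMoatCorePG_labelPaired_record {ϑc dL κ : ℝ} (hκ : 0 < κ)
    (hSC : CoolZoneShadowCrystalP ϑc (1 / 10) 8 4 12 16 (17 / 20) (1 / 10000) 5 (1 / 10000) 10 (43 / 2) 1 2 (1 / 16) (1 / 50))
    (hE : LabelSlavedFillingP ϑc tameRadius (1 / 10) 8 (145 / 16) 4 12 16 16 (17 / 20) (1 / 10000) 5 (1 / 10000) 10 (43 / 2) dL 1 2
      (1 / 16) (1 / 50))
    (hC : LabelSegmentCoercivityP ϑc tameRadius (1 / 10) 8 (145 / 16) 4 12 16 16 (17 / 20) (1 / 10000) 5 (1 / 10000) 10 (43 / 2) dL κ 1 2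
      (1 / 16) (1 / 50)) :
    MildCoolMoatCorePG ϑc tameRadius (1 / 10) 8 4 12 16 1 2 (1 / 16) (1 / 50) :=
  mildCoolMoatCorePG_of_labelSlavedFilling_coercivity hκ (by norm_num) hSC (bondLabelP₂_record ϑc) hE hC

end LabelPairedDoor

/-! ### ZZZP-3  W2 continued: the LOAD PATH FROM THE LABEL IMAGE — (XRᴸ) `LabelTubeReferenceP`, (X1ᴸ) `LabelTubeConvexityP`, (X2ᴸ)
`LabelLoadedTubeAprioriP` and the glue (QEᴸ)(dL := dB₁) ⟸ (XRᴸ) ∧ (X1ᴸ) ∧ (X2ᴸ) (PROVED, tree YO-4's engine verbatim) -/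

section LabelLoadPath

/-- **`IsFreeTubeReference ϑ₀ ϑ Rg sb dI dB X H y₀`** — tree YO's `IsTubeReference` with the METRIC MATCHING CLAUSE `dist (xf i) (z i) ≤ dm` DELETED:
the reference sites are `ϑ₀`-tame w.r.t. `X ∪ range y₀`, and every member `z` of the bond tube about `y₀` is injective, off `X` and `ϑ`-tame
sitewise w.r.t. `X ∪ range z`.  The actual core `xf` does not occur. [this file, g84] -/
def IsFreeTubeReference (ϑ₀ ϑ Rg sb dI dB : ℝ) (X H : Set E3) {n : ℕ} (y₀ : Fin n → E3) : Prop :=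
  (∀ i, IsTameStar ϑ₀ (X ∪ Set.range y₀) H (y₀ i)) ∧
    ∀ z ∈ bondTube X Rg sb dI dB y₀, Function.Injective z ∧ Disjoint (Set.range z) X ∧ ∀ i, IsTameStar ϑ (X ∪ Set.range z) H (z i)

/-- a (matched) tube reference is a free one. [this file, g84] -/
theorem IsTubeReference.free {ϑ₀ ϑ dm Rg sb dI dB : ℝ} {X H : Set E3} {n : ℕ} {xf y₀ : Fin n → E3}
    (h : IsTubeReference ϑ₀ ϑ dm Rg sb dI dB X H xf y₀) : IsFreeTubeReference ϑ₀ ϑ Rg sb dI dB X H y₀ :=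
  ⟨h.1, fun z hz => ⟨(h.2 z hz).1, (h.2 z hz).2.1, (h.2 z hz).2.2.2⟩⟩

/-- ★★ **(XRᴸ) «LabelTubeReferenceP … ϑ₀ Rg sb dI dB …» — THE LABEL IMAGE OF THE CORE IS A FREE TUBE REFERENCE.**  Under the binders of (QEᴸ), for
every cool shadow crystal and every bond label `lab`: the crystal patch `i ↦ lab (xf i)` is a free tube reference of radii `(Rg, sb, dI, dB)` and
levels `(ϑ₀, ϑ)`.  KINEMATIC · ATTACKABLE-S: the patch is a subset of the placed crystal `C` (label clause (i)), injective (clause (c)), equal to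
the core atoms within `ε` on the cool part `dist(·, K) > rΘ` (clause (iv)) hence seam-compatible with the `ε`-registered exterior, and COMPLETE
(covering (CV₂♮), tree ZZZOA `bondLabelCoveringP₂_record`: no site of `C` inside the patch region is missed); tameness of tube members is the
bookkeeping of `sb`/`dI`/`dB` against the `4`-stars exactly as for tree (XR), with the reference now an EXACT crystal patch instead of a bent chart
filling (no frame step, no registry-slip caveat).
Why it might fail: only the dial bookkeeping (`ϑ₀ + max(sb, dI, dB)·const ≤ ϑ`); injectivity / disjointness of tube members need `dB <` half
the separation of `C` (`17/40`).
Sources: tree YO ((XR), `IsTubeReference`); tree ZC/ZZZD/ZZZOA (bond labels, covering); memo NODE-g84 §3. [this file, g84] -/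
def LabelTubeReferenceP (ϑc ϑ ϑp r rΘ q rsh ρ rm σ ϑr Rs ε rI ℓ ϑ₀ Rg sb dI dB aHi Λ θ s : ℝ) : Prop :=
  ∀ δ : ℝ, 0 < δ → ∀ a : ℝ, 0 < a →
    ∀ S : Set E3, IsDoorSetP aHi δ S → (∀ z : E3, Summable fun y : S => lennardJones (dist z (y : E3))) →
      (∀ p ∈ S, IsTwoShellAffineGood θ S p) →
        ∀ (L : E3 ≃L[ℝ] E3) (w : ℤ → E3), IsEquilChart a s Λ L w →
          ∀ (x₀ : E3) (K : Set E3), K ⊆ S → (∀ k ∈ K, dist k x₀ ≤ q) →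
            IsTameOn ϑp S (LayeredHom (L : E3 →L[ℝ] E3) w) (coreOf S K rm) →
              IsTameOn ϑc S (LayeredHom (L : E3 →L[ℝ] E3) w) (moatIn S K r (r + rsh)) →
                ∀ (n : ℕ) (xf : Fin n → E3), Function.Injective xf → Set.range xf = coreOf S K ρ →
                  ∀ (L' : E3 →L[ℝ] E3) (w' : ℤ → E3) (U : E3 ≃ₗᵢ[ℝ] E3) (t : E3),
                    IsCoolShadowCrystal σ ϑr Rs ε r rI ℓ S K (LayeredHom (L : E3 →L[ℝ] E3) w) L' w' U t →
                      ∀ lab : E3 → E3, IsBondLabel ε rΘ ℓ S K (placedCrystal L' w' U t) lab →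
                        IsFreeTubeReference ϑ₀ ϑ Rg sb dI dB (S \ coreOf S K ρ) (LayeredHom (L : E3 →L[ℝ] E3) w) (fun i => lab (xf i))

/-- ★★★ **(X1ᴸ) «LabelTubeConvexityP … lam …» — FIRST-ORDER STRONG CONVEXITY OF THE CLAMPED ENERGY ON THE BOND TUBE ABOUT THE LABEL IMAGE.**  Tree
(X1) `TubeConvexityP` with the reference specialised to the crystal patch `lab ∘ xf` (hypothesis: it is a free tube reference).  CERT-type ·
INSTRUMENTABLE (NearBorn-T of row 1237, unchanged: the instrument never used the matching clause) · WEAKER than the matching-free ∀-reference form.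
Why it might fail / Sources: as tree (X1). [this file, g84] -/
def LabelTubeConvexityP (ϑc ϑ ϑp r rΘ q rsh ρ rm σ ϑr Rs ε rI ℓ ϑ₀ Rg sb dI dB lam aHi Λ θ s : ℝ) : Prop :=
  ∀ δ : ℝ, 0 < δ → ∀ a : ℝ, 0 < a →
    ∀ S : Set E3, IsDoorSetP aHi δ S → (∀ z : E3, Summable fun y : S => lennardJones (dist z (y : E3))) →
      (∀ p ∈ S, IsTwoShellAffineGood θ S p) →
        ∀ (L : E3 ≃L[ℝ] E3) (w : ℤ → E3), IsEquilChart a s Λ L w →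
          ∀ (x₀ : E3) (K : Set E3), K ⊆ S → (∀ k ∈ K, dist k x₀ ≤ q) →
            IsTameOn ϑp S (LayeredHom (L : E3 →L[ℝ] E3) w) (coreOf S K rm) →
              IsTameOn ϑc S (LayeredHom (L : E3 →L[ℝ] E3) w) (moatIn S K r (r + rsh)) →
                ∀ (n : ℕ) (xf : Fin n → E3), Function.Injective xf → Set.range xf = coreOf S K ρ →
                  ∀ (L' : E3 →L[ℝ] E3) (w' : ℤ → E3) (U : E3 ≃ₗᵢ[ℝ] E3) (t : E3),
                    IsCoolShadowCrystal σ ϑr Rs ε r rI ℓ S K (LayeredHom (L : E3 →L[ℝ] E3) w) L' w' U t →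
                      ∀ lab : E3 → E3, IsBondLabel ε rΘ ℓ S K (placedCrystal L' w' U t) lab →
                        IsFreeTubeReference ϑ₀ ϑ Rg sb dI dB (S \ coreOf S K ρ) (LayeredHom (L : E3 →L[ℝ] E3) w) (fun i => lab (xf i)) →
                          ∀ z ∈ bondTube (S \ coreOf S K ρ) Rg sb dI dB (fun i => lab (xf i)), ∃ φ : (Fin n → E3) →L[ℝ] ℝ,
                            HasFDerivAt (fun z : Fin n → E3 => clampedEnergy (S \ coreOf S K ρ) z) φ z ∧
                              ∀ z' ∈ bondTube (S \ coreOf S K ρ) Rg sb dI dB (fun i => lab (xf i)),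
                                clampedEnergy (S \ coreOf S K ρ) z + φ (z' - z) + lam * ∑ i, dist (z i) (z' i) ^ 2 ≤
                                  clampedEnergy (S \ coreOf S K ρ) z'

/-- ★★★ **(X2ᴸ) «LabelLoadedTubeAprioriP … sb₁ dI₁ dB₁ …» — A-PRIORI CONFINEMENT OF THE LOADED SOLUTIONS TO THE INNER TUBE ABOUT THE LABEL IMAGE.**
Tree (X2ᴸ)/(X2ᴸ♮) with the reference specialised to the crystal patch `lab ∘ xf`: its residual load `φ₀ = D(clampedEnergy)(lab ∘ xf)` is the force
on an EXACT crystal patch glued to the `ε`-registered exterior (first-order seam forces `O(ε)` on the `≤ Rg`-collar of the patch, `r⁻⁶` tails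
beyond), and every loaded critical member of the outer tube lies in the inner tube `(sb₁, dI₁, dB₁)`.  ANALYTIC · HEAVY · UNDECIDED · LINEARISABLE
(max-norm bound for the clamped lattice Green's operator, as tree (X2ᴸ)) · INSTRUMENTABLE (FillTame-T of row 1237 run from the crystal patch).
Why it might fail / Sources: as tree (X2ᴸ) (YO) and (X2ᴸ♮) (YY). [this file, g84] -/
def LabelLoadedTubeAprioriP (ϑc ϑ ϑp r rΘ q rsh ρ rm σ ϑr Rs ε rI ℓ ϑ₀ Rg sb dI dB sb₁ dI₁ dB₁ aHi Λ θ s : ℝ) : Prop :=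
  ∀ δ : ℝ, 0 < δ → ∀ a : ℝ, 0 < a →
    ∀ S : Set E3, IsDoorSetP aHi δ S → (∀ z : E3, Summable fun y : S => lennardJones (dist z (y : E3))) →
      (∀ p ∈ S, IsTwoShellAffineGood θ S p) →
        ∀ (L : E3 ≃L[ℝ] E3) (w : ℤ → E3), IsEquilChart a s Λ L w →
          ∀ (x₀ : E3) (K : Set E3), K ⊆ S → (∀ k ∈ K, dist k x₀ ≤ q) →
            IsTameOn ϑp S (LayeredHom (L : E3 →L[ℝ] E3) w) (coreOf S K rm) →
              IsTameOn ϑc S (LayeredHom (L : E3 →L[ℝ] E3) w) (moatIn S K r (r + rsh)) →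
                ∀ (n : ℕ) (xf : Fin n → E3), Function.Injective xf → Set.range xf = coreOf S K ρ →
                  ∀ (L' : E3 →L[ℝ] E3) (w' : ℤ → E3) (U : E3 ≃ₗᵢ[ℝ] E3) (t : E3),
                    IsCoolShadowCrystal σ ϑr Rs ε r rI ℓ S K (LayeredHom (L : E3 →L[ℝ] E3) w) L' w' U t →
                      ∀ lab : E3 → E3, IsBondLabel ε rΘ ℓ S K (placedCrystal L' w' U t) lab →
                        IsFreeTubeReference ϑ₀ ϑ Rg sb dI dB (S \ coreOf S K ρ) (LayeredHom (L : E3 →L[ℝ] E3) w) (fun i => lab (xf i)) →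
                          ∀ φ₀ : (Fin n → E3) →L[ℝ] ℝ,
                            HasFDerivAt (fun z : Fin n → E3 => clampedEnergy (S \ coreOf S K ρ) z) φ₀ (fun i => lab (xf i)) →
                              ∀ t₁ : ℝ, 0 ≤ t₁ → t₁ ≤ 1 → ∀ z ∈ bondTube (S \ coreOf S K ρ) Rg sb dI dB (fun i => lab (xf i)),
                                HasFDerivAt (fun z : Fin n → E3 => clampedEnergy (S \ coreOf S K ρ) z) ((1 - t₁) • φ₀) z →
                                  z ∈ bondTube (S \ coreOf S K ρ) Rg sb₁ dI₁ dB₁ (fun i => lab (xf i))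

/-- ★★★ **THE LABEL LOAD-PATH GLUE (PROVED): (XRᴸ) ∧ (X1ᴸ)(lam > 0) ∧ (X2ᴸ)(0 ≤ sb₁ < sb, 0 ≤ dI₁ < dI, 0 ≤ dB₁ < dB) ⇒ (QEᴸ)(dL := dB₁).**  Tree YO-4's
proof (`coolMoatSlavedFillingP_of_loadPath`: the engine `exists_hasFDerivAt_zero_of_loadPath` on the convex compact bond tube with gap
`min((sb − sb₁)/4, (dI − dI₁)/2, (dB − dB₁)/2)`) with the reference `y₀ := lab ∘ xf`; the bulk pin of the inner tube is clause (ii′). [this file, g84] -/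
theorem labelSlavedFillingP_of_loadPath {ϑc ϑ ϑp r rΘ q rsh ρ rm σ ϑr Rs ε rI ℓ ϑ₀ Rg sb dI dB sb₁ dI₁ dB₁ lam aHi Λ θ s : ℝ}
    (hlam : 0 < lam) (hsb : sb₁ < sb) (hdI : dI₁ < dI) (hdB : dB₁ < dB) (hsb₀ : 0 ≤ sb₁) (hdI₀ : 0 ≤ dI₁) (hdB₀ : 0 ≤ dB₁)
    (hR : LabelTubeReferenceP ϑc ϑ ϑp r rΘ q rsh ρ rm σ ϑr Rs ε rI ℓ ϑ₀ Rg sb dI dB aHi Λ θ s)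
    (hC : LabelTubeConvexityP ϑc ϑ ϑp r rΘ q rsh ρ rm σ ϑr Rs ε rI ℓ ϑ₀ Rg sb dI dB lam aHi Λ θ s)
    (hA : LabelLoadedTubeAprioriP ϑc ϑ ϑp r rΘ q rsh ρ rm σ ϑr Rs ε rI ℓ ϑ₀ Rg sb dI dB sb₁ dI₁ dB₁ aHi Λ θ s) :
    LabelSlavedFillingP ϑc ϑ ϑp r rΘ q rsh ρ rm σ ϑr Rs ε rI ℓ dB₁ aHi Λ θ s := by
  intro δ hδ a ha S hS hsum hgood L w hLw x₀ K hKS hKq hmild hcool n xf hxf hrange L' w' U t hCr lab hlab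
  have hy₀ := hR δ hδ a ha S hS hsum hgood L w hLw x₀ K hKS hKq hmild hcool n xf hxf hrange L' w' U t hCr lab hlab
  have hSC := hC δ hδ a ha S hS hsum hgood L w hLw x₀ K hKS hKq hmild hcool n xf hxf hrange L' w' U t hCr lab hlab hy₀
  set y₀ : Fin n → E3 := fun i => lab (xf i) with hy₀def
  have hT₁T : bondTube (S \ coreOf S K ρ) Rg sb₁ dI₁ dB₁ y₀ ⊆ bondTube (S \ coreOf S K ρ) Rg sb dI dB y₀ :=
    bondTube_mono hsb.le hdI.le hdB.le
  have hy₀T₁ : y₀ ∈ bondTube (S \ coreOf S K ρ) Rg sb₁ dI₁ dB₁ y₀ := self_mem_bondTube hsb₀ hdI₀ hdB₀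
  obtain ⟨φ₀, hφ₀, -⟩ := hSC y₀ (hT₁T hy₀T₁)
  have hAp := hA δ hδ a ha S hS hsum hgood L w hLw x₀ K hKS hKq hmild hcool n xf hxf hrange L' w' U t hCr lab hlab hy₀ φ₀ hφ₀
  have hgap : 0 < min ((sb - sb₁) / 4) (min ((dI - dI₁) / 2) ((dB - dB₁) / 2)) :=
    lt_min (by linarith) (lt_min (by linarith) (by linarith))
  obtain ⟨z, hz₁, hz⟩ := exists_hasFDerivAt_zero_of_loadPath
    (E := fun z : Fin n → E3 => clampedEnergy (S \ coreOf S K ρ) z) (D := fun z z' : Fin n → E3 => ∑ i, dist (z i) (z' i) ^ 2)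
    (isCompact_bondTube (hdB₀.trans hdB.le)) convex_bondTube hT₁T hy₀T₁ hgap
    (fun z hz z' hz' => bondTube_margin
      (by linarith [min_le_left ((sb - sb₁) / 4) (min ((dI - dI₁) / 2) ((dB - dB₁) / 2))])
      (by linarith [(min_le_right ((sb - sb₁) / 4) (min ((dI - dI₁) / 2) ((dB - dB₁) / 2))).trans (min_le_left _ _)])
      (by linarith [(min_le_right ((sb - sb₁) / 4) (min ((dI - dI₁) / 2) ((dB - dB₁) / 2))).trans (min_le_right _ _)]) hz hz')
    hlam (fun z z' => norm_sub_sq_le_sum_dist_sq z z') hφ₀ hSC hAp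
  obtain ⟨hinj, hdisj, htame⟩ := hy₀.2 z (hT₁T hz₁)
  exact ⟨z, hinj, hdisj, hz, htame, fun i => by rw [dist_comm]; exact hz₁.2.2 i⟩

/-- ★★ **W2 ASSEMBLED AT THE DOCKET GEOMETRY (PROVED modulo its five hypotheses)**: `(r, rΘ, q, rsh, ρ, rm) = (8, 145/16, 4, 12, 16, 16)`, shadow-crystal
dials `(σ, ϑr, Rs, ε, rI, ℓ) = (17/20, 10⁻⁴, 5, 10⁻⁴, 10, 43/2)`, `(aHi, Λ, θ, s) = (1, 2, 1/16, 1/50)`, door level `ϑ = tameRadius`; (GL₂) discharged by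
tree ZZZK `bondLabelP₂_record`; tube radii, reference level `ϑ₀`, moduli `lam`, `κ` FREE.  The mild door [MCMC](ϑc) ⟸ (SC) ∧ (XRᴸ) ∧ (X1ᴸ) ∧ (X2ᴸ) ∧
(QCᴸ)(dL := dB₁). [this file, g84] -/
theorem mildCoolMoatCorePG_W2_record {ϑc ϑ₀ Rg sb dI dB sb₁ dI₁ dB₁ lam κ : ℝ}
    (hlam : 0 < lam) (hκ : 0 < κ) (hsb : sb₁ < sb) (hdI : dI₁ < dI) (hdB : dB₁ < dB) (hsb₀ : 0 ≤ sb₁) (hdI₀ : 0 ≤ dI₁) (hdB₀ : 0 ≤ dB₁)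
    (hSC : CoolZoneShadowCrystalP ϑc (1 / 10) 8 4 12 16 (17 / 20) (1 / 10000) 5 (1 / 10000) 10 (43 / 2) 1 2 (1 / 16) (1 / 50))
    (hR : LabelTubeReferenceP ϑc tameRadius (1 / 10) 8 (145 / 16) 4 12 16 16 (17 / 20) (1 / 10000) 5 (1 / 10000) 10 (43 / 2) ϑ₀ Rg sb dI dB
      1 2 (1 / 16) (1 / 50))
    (hX1 : LabelTubeConvexityP ϑc tameRadius (1 / 10) 8 (145 / 16) 4 12 16 16 (17 / 20) (1 / 10000) 5 (1 / 10000) 10 (43 / 2) ϑ₀ Rg sb dI dB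
      lam 1 2 (1 / 16) (1 / 50))
    (hX2 : LabelLoadedTubeAprioriP ϑc tameRadius (1 / 10) 8 (145 / 16) 4 12 16 16 (17 / 20) (1 / 10000) 5 (1 / 10000) 10 (43 / 2) ϑ₀ Rg sb dI
      dB sb₁ dI₁ dB₁ 1 2 (1 / 16) (1 / 50))
    (hQC : LabelSegmentCoercivityP ϑc tameRadius (1 / 10) 8 (145 / 16) 4 12 16 16 (17 / 20) (1 / 10000) 5 (1 / 10000) 10 (43 / 2) dB₁ κ 1 2
      (1 / 16) (1 / 50)) :
    MildCoolMoatCorePG ϑc tameRadius (1 / 10) 8 4 12 16 1 2 (1 / 16) (1 / 50) :=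
  mildCoolMoatCorePG_labelPaired_record hκ hSC (labelSlavedFillingP_of_loadPath hlam hsb hdI hdB hsb₀ hdI₀ hdB₀ hR hX1 hX2) hQC

end LabelLoadPath

end Summit.AtomisticToContinuum.Crystallization.Theorems.ChartedZeroExcessLayeredLatticeLiouville

end
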